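import Mathlib.RingTheory.MvPolynomial.Ideal
import Mathlib.RingTheory.RegularLocalRing.Polynomial
import Mathlib.RingTheory.Localization.AtPrime.Basic
import Mathlib.RingTheory.Ideal.IsPrimary
import Mathlib.Algebra.CharP.Algebra
import Mathlib.FieldTheory.Finite.Basic
import Summits.ResolutionOfSingularities.ResolutionOfSingularities.Theorems.FrobeniusLadderFInjectiveMacaulayficationFedderCriterion
import HarnessLib

/-!
# Fedder's test at the origin of affine space: the crux's clause for polynomial hypersurface germs

Support file for crux stmt-ResolutionOfSingularities-15315 (`FrobeniusLadder.FInjectiveMacaulayfication`,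
line `Sketch`): the polynomial-level form of certification engine E2 (`Fedder.fedder_criterion`,
p132710). Let `k` be a field of characteristic `p`, `S = k[X₀, …, X_{n-1}]`, `P = (X₀, …, X_{n-1})`
(a maximal ideal, `isMaximal_span_range_X`), `R = S_P` (a regular local ring) and `g ∈ P`, `g ≠ 0`.

* `algebraMap_pow_mem_frobeniusPower_maximalIdeal_iff` — the Fedder test moves between `S` and `R`:
  `(g)^(p-1) ∈ 𝔪_R^[p]` in `R` iff `g^(p-1) ∈ (X₀^p, …, X_{n-1}^p)` in `S` (`𝔪_R = P R`,
  `(P R)^[p] = P^[p] R`, and `P^[p] = (Xᵢ^p)` is `P`-primary, so it contracts to itself).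
* `fedder_criterion_origin` — **the local ring `R/(g)` of the hypersurface `{g = 0}` at the origin
  satisfies the per-stalk clause of crux `FInjectiveMacaulayfication` (all s.o.p. weakly regular, all
  parameter ideals Frobenius closed) iff `g^(p-1) ∉ (X₀^p, …, X_{n-1}^p)`** — a finite check on the
  monomials of `g^(p-1)` (a monomial ideal contains a polynomial iff it contains each of its monomials,
  Mathlib `MvPolynomial.mem_ideal_span_monomial_image`).

This is the decision procedure the disprover's specimens (`E₈⁰` for `p ≤ 5`, the Cossart–Piltant form
`Z^p + u₄u₁^p + u₃u₂^p`, the cusp, Hauser's kangaroo surface) fail and the chart points of the crux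
cards' toy towers pass; both directions are now one membership statement away from the clause.

References: [Fedder1983] Prop. 1.7, Thm. 1.12.
-/

-- single-problem summit: the doubled namespace component `ResolutionOfSingularities` is forced
set_option linter.dupNamespace false

namespace Summit.ResolutionOfSingularities.ResolutionOfSingularities.Theorems.FInjectiveMacaulayfication.Fedder

open MvPolynomial IsLocalRing Literature.RingTheory.TightClosure

section Origin

variable (k : Type) [Field k] (n : ℕ)

/-- The ideal `(X₀, …, X_{n-1})` of `k[X₀, …, X_{n-1}]` is the kernel of the constant-coefficient map.
[folklore] -/
theorem span_range_X_eq_ker :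
    Ideal.span (Set.range (X : Fin n → MvPolynomial (Fin n) k)) =
      RingHom.ker (constantCoeff : MvPolynomial (Fin n) k →+* k) := by
  apply le_antisymm
  · rw [Ideal.span_le]
    rintro _ ⟨i, rfl⟩
    rw [SetLike.mem_coe, RingHom.mem_ker, constantCoeff_X]
  · intro h hh
    rw [RingHom.mem_ker] at hh
    rw [← Set.image_univ, mem_ideal_span_X_image]
    intro m hm
    by_contra hne
    push Not at hne
    have hm0 : m = 0 := Finsupp.ext fun i => hne i (Set.mem_univ i)
    rw [hm0, mem_support_iff, ← constantCoeff_eq, hh] at hm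
    exact hm rfl

/-- `(X₀, …, X_{n-1})` is a maximal ideal of `k[X₀, …, X_{n-1}]` (the point `0 ∈ 𝔸ⁿ`). [folklore] -/
theorem isMaximal_span_range_X :
    (Ideal.span (Set.range (X : Fin n → MvPolynomial (Fin n) k))).IsMaximal := by
  rw [span_range_X_eq_ker]
  exact RingHom.ker_isMaximal_of_surjective _ fun a => ⟨C a, constantCoeff_C _ a⟩

variable (p : ℕ) [Fact p.Prime] [CharP k p]

/-- **Transport of Fedder's test between `S = k[X]` and the local ring `R = S_P` at the origin**
(`P = (X₀, …, X_{n-1})`): for `g ∈ S` and `r : ℕ`, the image of `g^r` lies in `𝔪_R^[p]` iff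
`g^r ∈ (X₀^p, …, X_{n-1}^p)`. (`𝔪_R = P R`; Frobenius powers commute with extension; `(Xᵢ^p) = P^[p]`
is `P`-primary, hence contracted from `R`.) [folklore] -/
theorem algebraMap_pow_mem_frobeniusPower_maximalIdeal_iff (P : Ideal (MvPolynomial (Fin n) k))
    [P.IsMaximal] (hP : P = Ideal.span (Set.range (X : Fin n → MvPolynomial (Fin n) k)))
    [CharP (Localization.AtPrime P) p] (g : MvPolynomial (Fin n) k) (r : ℕ) :
    (algebraMap (MvPolynomial (Fin n) k) (Localization.AtPrime P) g) ^ r ∈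
        frobeniusPower p (maximalIdeal (Localization.AtPrime P)) ↔
      g ^ r ∈ Ideal.span (Set.range fun i : Fin n => (X i : MvPolynomial (Fin n) k) ^ p) := by
  set Q : Ideal (MvPolynomial (Fin n) k) :=
    Ideal.span (Set.range fun i : Fin n => (X i : MvPolynomial (Fin n) k) ^ p) with hQ
  -- `P^[p] = Q`
  have hPQ : frobeniusPower p P = Q := by
    have h := frobeniusPower_span (R := MvPolynomial (Fin n) k) p 1
      (Set.range (X : Fin n → MvPolynomial (Fin n) k))
    rw [pow_one, ← hP, ← Set.range_comp] at h
    exact h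
  -- `𝔪_R^[p] = Q R`
  have hmR : frobeniusPower p (maximalIdeal (Localization.AtPrime P)) =
      Q.map (algebraMap (MvPolynomial (Fin n) k) (Localization.AtPrime P)) := by
    rw [← IsLocalization.AtPrime.map_eq_maximalIdeal P (Localization.AtPrime P), ← pow_one p,
      frobeniusPower_map p _ 1, pow_one, hPQ]
  rw [hmR, ← map_pow]
  constructor
  · -- contraction: `Q` is `P`-primary
    intro hmem
    have hp0 : p ≠ 0 := (Fact.out : p.Prime).ne_zero
    have hQP : Q ≤ P := by
      rw [hQ, Ideal.span_le]
      rintro _ ⟨i, rfl⟩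
      exact Ideal.pow_mem_of_mem P (hP ▸ Ideal.subset_span ⟨i, rfl⟩) p (Nat.pos_of_ne_zero hp0)
    have hrad : Q.radical = P := by
      refine le_antisymm ((Ideal.IsMaximal.isPrime' P).radical_le_iff.mpr hQP) ?_
      rw [hP, Ideal.span_le]
      rintro _ ⟨i, rfl⟩
      exact ⟨p, Ideal.subset_span ⟨i, rfl⟩⟩
    have hprim : Q.IsPrimary := Ideal.isPrimary_of_isMaximal_radical (hrad ▸ inferInstance)
    rw [IsLocalization.mem_map_algebraMap_iff P.primeCompl (Localization.AtPrime P)] at hmem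
    obtain ⟨⟨⟨a, ha⟩, ⟨s, hs⟩⟩, h⟩ := hmem
    dsimp only at h
    rw [← map_mul] at h
    have hinj : Function.Injective (algebraMap (MvPolynomial (Fin n) k) (Localization.AtPrime P)) :=
      IsLocalization.injective (Localization.AtPrime P) P.primeCompl_le_nonZeroDivisors
    have h' : g ^ r * s ∈ Q := by rw [hinj h]; exact ha
    rcases (Ideal.isPrimary_iff.mp hprim).2 h' with h1 | h1
    · exact h1
    · exact absurd (hrad ▸ h1) hs
  · -- extension
    intro hmem
    exact Ideal.mem_map_of_mem _ hmem

/-- **Fedder's test at the origin of `𝔸ⁿ`.** For a field `k` of characteristic `p`,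
`S = k[X₀, …, X_{n-1}]`, `P = (X₀, …, X_{n-1})`, `R = S_P` and `g ∈ P`, `g ≠ 0`: the hypersurface local
ring `R/(g)` satisfies the per-stalk clause of crux `FInjectiveMacaulayfication` — every system of
parameters weakly regular and every parameter ideal Frobenius closed (Cohen–Macaulay + F-injective) —
**iff** `g^(p-1) ∉ (X₀^p, …, X_{n-1}^p)`. (`Fedder.fedder_hypersurface_clause_iff` in the regular local
ring `R`, moved to `S` by `algebraMap_pow_mem_frobeniusPower_maximalIdeal_iff`.)
[cite: Fedder1983, Prop. 1.7 and Thm. 1.12] -/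
theorem fedder_criterion_origin : ∀ (p : ℕ) [Fact p.Prime] (k : Type) [Field k] [CharP k p] (n : ℕ) (P : Ideal (MvPolynomial (Fin n) k)) [P.IsMaximal], P = Ideal.span (Set.range (MvPolynomial.X : Fin n → MvPolynomial (Fin n) k)) → ∀ g : MvPolynomial (Fin n) k, g ∈ P → g ≠ 0 → ((∀ d : ℕ, ringKrullDim (Localization.AtPrime P ⧸ Ideal.span {algebraMap (MvPolynomial (Fin n) k) (Localization.AtPrime P) g}) = d → ∀ s : Fin d → Localization.AtPrime P ⧸ Ideal.span {algebraMap (MvPolynomial (Fin n) k) (Localization.AtPrime P) g}, Ideal.IsMaximal (Ideal.radical (Ideal.span (Set.range s))) → RingTheory.Sequence.IsWeaklyRegular (Localization.AtPrime P ⧸ Ideal.span {algebraMap (MvPolynomial (Fin n) k) (Localization.AtPrime P) g}) (List.ofFn s) ∧ ∀ y : Localization.AtPrime P ⧸ Ideal.span {algebraMap (MvPolynomial (Fin n) k) (Localization.AtPrime P) g}, (∃ e : ℕ, y ^ p ^ e ∈ Ideal.span ((fun z : Localization.AtPrime P ⧸ Ideal.span {algebraMap (MvPolynomial (Fin n) k)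 (Localization.AtPrime P) g} => z ^ p ^ e) '' (Ideal.span (Set.range s) : Set (Localization.AtPrime P ⧸ Ideal.span {algebraMap (MvPolynomial (Fin n) k) (Localization.AtPrime P) g})))) → y ∈ Ideal.span (Set.range s)) ↔ g ^ (p - 1) ∉ Ideal.span (Set.range fun i : Fin n => (MvPolynomial.X i : MvPolynomial (Fin n) k) ^ p)) := by
  intro p _ k _ _ n P _ hP g hgP hg0
  -- `R = S_P` is a regular local ring of characteristic `p`, `g ↦` a non-zero element of `𝔪_R`
  haveI : IsRegularLocalRing (Localization.AtPrime P) := IsRegularRing.isRegularLocalRing_localization P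
  have hinj : Function.Injective (algebraMap (MvPolynomial (Fin n) k) (Localization.AtPrime P)) :=
    IsLocalization.injective (Localization.AtPrime P) P.primeCompl_le_nonZeroDivisors
  haveI : CharP (Localization.AtPrime P) p := charP_of_injective_algebraMap hinj p
  have hgm : algebraMap (MvPolynomial (Fin n) k) (Localization.AtPrime P) g ∈
      maximalIdeal (Localization.AtPrime P) := by
    rw [← IsLocalization.AtPrime.map_eq_maximalIdeal P (Localization.AtPrime P)]
    exact Ideal.mem_map_of_mem _ hgP
  have hg0' : algebraMap (MvPolynomial (Fin n) k) (Localization.AtPrime P) g ≠ 0 := by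
    intro h
    exact hg0 (hinj (by rw [h, map_zero]))
  rw [fedder_hypersurface_clause_iff p hgm hg0',
    algebraMap_pow_mem_frobeniusPower_maximalIdeal_iff k n p P hP g (p - 1)]

end Origin

/-! ## §2 Calibration: the point blow-up F-injectivizes `E₈⁰` in characteristic 5

The rational double point `E₈⁰ : z² + x³ + y⁵ = 0` is Cohen–Macaulay but NOT F-injective in
characteristic `5`: `f⁴ ∈ (x⁵, y⁵, z⁵)` (`e8_pow_four_mem`), so by `fedder_criterion_origin` its local
ring at the origin violates the per-stalk clause (`e8_origin_not_clause_char5`), and by the complete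
parameter-centre no-go (p131741) no blow-up of a parameter ideal can serve as the crux's model over it.
The blow-up of the MAXIMAL ideal does: on the chart `x = yu, z = yv` the strict transform of `f` is
`g = v² + y u³ + y³` (`e8_strictTransform_chart_y`; an `E₇`-type point at the origin `u = v = y = 0`,
the only singular point of the blow-up), `g⁴ = 12·u³v⁴y⁴ + (element of (u⁵, v⁵, y⁵))` with
`12 ≢ 0 (mod 5)` (`e7_pow_four_eq`, `e7_fedder_char5`), and **the local ring of the blow-up at that
point satisfies the clause** (`e7_chart_point_clause_char5`). This is the first certified instance,
inside the crux's own vocabulary, of a NON-parameter centre (`𝔪`: three generators on a surface,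
`ν = 3 ≥ c + 2`) turning a non-F-injective Cohen–Macaulay point into points satisfying the clause —
the `p = 5` row of the toy table of crux cards `graded-cartier-criterion` / `cartier-contraction-centres`
(`toy-cartier-e8.md`). The smooth points of the blow-up satisfy the clause by `RegularStalksClimb`; the
global statement about `Bl_𝔪 E₈⁰` (blow-ups of affine schemes) is not needed for the calibration.
[Artin1977] M. Artin, Coverings of the rational double points in characteristic `p` (forms `E₈⁰`, `E₇`).
-/

end Summit.ResolutionOfSingularities.ResolutionOfSingularities.Theorems.FInjectiveMacaulayfication.Fedder

namespace Summit.ResolutionOfSingularities.ResolutionOfSingularities.Theorems.FInjectiveMacaulayfication.E8Char5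

open MvPolynomial IsLocalRing Literature.RingTheory.TightClosure
open Summit.ResolutionOfSingularities.ResolutionOfSingularities.Theorems.FInjectiveMacaulayfication.Fedder

section Poly

variable (k : Type) [CommRing k]

/-- **The `y`-chart of the point blow-up of `E₈⁰`.** Substituting `x = yu`, `y = y`, `z = yv`
(coordinates `X 0 = u`, `X 1 = v`, `X 2 = y` upstairs; `X 0 = x`, `X 1 = y`, `X 2 = z` downstairs) into
`f = z² + x³ + y⁵` gives `y² · g` with the strict transform `g = v² + y u³ + y³`. [folklore] -/
theorem e8_strictTransform_chart_y :
    MvPolynomial.aeval (fun i : Fin 3 => (![X 2 * X 0, X 2, X 2 * X 1] : Fin 3 → MvPolynomial (Fin 3) k) i)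
        (X 2 ^ 2 + X 0 ^ 3 + X 1 ^ 5 : MvPolynomial (Fin 3) k) =
      X 2 ^ 2 * (X 1 ^ 2 + X 2 * X 0 ^ 3 + X 2 ^ 3) := by
  simp only [map_add, map_pow, MvPolynomial.aeval_X]
  simp only [Matrix.cons_val_zero, Matrix.cons_val_one, Matrix.cons_val]
  ring

/-- **`E₈⁰` fails Fedder's test at `p = 5`:** `f⁴ ∈ (x⁵, y⁵, z⁵)` for `f = z² + x³ + y⁵` — every
monomial `z^{2a} x^{3b} y^{5c}` of `f⁴` (`a + b + c = 4`) has an exponent `≥ 5`; explicit cofactors.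
[cite: Fedder1983, Prop. 1.7] -/
theorem e8_pow_four_mem :
    (X 2 ^ 2 + X 0 ^ 3 + X 1 ^ 5 : MvPolynomial (Fin 3) k) ^ 4 ∈
      Ideal.span (Set.range fun i : Fin 3 => (X i : MvPolynomial (Fin 3) k) ^ 5) := by
  have hX : ∀ i : Fin 3, (X i : MvPolynomial (Fin 3) k) ^ 5 ∈
      Ideal.span (Set.range fun i : Fin 3 => (X i : MvPolynomial (Fin 3) k) ^ 5) :=
    fun i => Ideal.subset_span ⟨i, rfl⟩
  have h : (X 2 ^ 2 + X 0 ^ 3 + X 1 ^ 5 : MvPolynomial (Fin 3) k) ^ 4 =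
      (6 * X 0 * X 2 ^ 4 + 12 * X 0 * X 1 ^ 5 * X 2 ^ 2 + 6 * X 0 * X 1 ^ 10 + 4 * X 0 ^ 4 * X 2 ^ 2 +
          4 * X 0 ^ 4 * X 1 ^ 5 + X 0 ^ 7) * X 0 ^ 5 +
        (4 * X 2 ^ 6 + 6 * X 1 ^ 5 * X 2 ^ 4 + 4 * X 1 ^ 10 * X 2 ^ 2 + X 1 ^ 15 + 12 * X 0 ^ 3 * X 2 ^ 4 +
          12 * X 0 ^ 3 * X 1 ^ 5 * X 2 ^ 2 + 4 * X 0 ^ 3 * X 1 ^ 10) * X 1 ^ 5 +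
        (X 2 ^ 3 + 4 * X 0 ^ 3 * X 2) * X 2 ^ 5 := by
    ring
  rw [h]
  exact add_mem (add_mem (Ideal.mul_mem_left _ _ (hX 0)) (Ideal.mul_mem_left _ _ (hX 1)))
    (Ideal.mul_mem_left _ _ (hX 2))

/-- **Fedder's monomial for `E₇ = v² + y u³ + y³` at `p = 5`:** `g⁴ = 12·u³v⁴y⁴` modulo the Frobenius
power `(u⁵, v⁵, y⁵)` of the maximal ideal, with explicit cofactors. [cite: Fedder1983, Prop. 1.7] -/
theorem e7_pow_four_eq :
    (X 1 ^ 2 + X 2 * X 0 ^ 3 + X 2 ^ 3 : MvPolynomial (Fin 3) k) ^ 4 =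
      12 * (X 0 ^ 3 * X 1 ^ 4 * X 2 ^ 4) +
      ((6 * X 0 * X 2 ^ 8 + 12 * X 0 * X 1 ^ 2 * X 2 ^ 5 + 6 * X 0 * X 1 ^ 4 * X 2 ^ 2 +
          4 * X 0 ^ 4 * X 2 ^ 6 + 4 * X 0 ^ 4 * X 1 ^ 2 * X 2 ^ 3 + X 0 ^ 7 * X 2 ^ 4) * X 0 ^ 5 +
        (4 * X 1 * X 2 ^ 3 + X 1 ^ 3 + 4 * X 0 ^ 3 * X 1 * X 2) * X 1 ^ 5 +
        (X 2 ^ 7 + 4 * X 1 ^ 2 * X 2 ^ 4 + 6 * X 1 ^ 4 * X 2 + 4 * X 0 ^ 3 * X 2 ^ 5 +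
          12 * X 0 ^ 3 * X 1 ^ 2 * X 2 ^ 2) * X 2 ^ 5) := by
  ring

end Poly

section FieldCase

variable (k : Type) [Field k]

/-- The monomial `u³v⁴y⁴` is not in the monomial ideal `(u⁵, v⁵, y⁵)` (no exponent reaches `5`).
[folklore] -/
theorem monomial_notMem_frobeniusSpan :
    (X 0 ^ 3 * X 1 ^ 4 * X 2 ^ 4 : MvPolynomial (Fin 3) k) ∉
      Ideal.span (Set.range fun i : Fin 3 => (X i : MvPolynomial (Fin 3) k) ^ 5) := by
  classical
  have hrange : (Set.range fun i : Fin 3 => (X i : MvPolynomial (Fin 3) k) ^ 5) =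
      (fun s => monomial s (1 : k)) '' Set.range (fun i : Fin 3 => Finsupp.single i 5) := by
    rw [← Set.range_comp]
    refine congrArg Set.range (funext fun i => ?_)
    simp only [Function.comp_apply, X_pow_eq_monomial]
  have hmon : (X 0 ^ 3 * X 1 ^ 4 * X 2 ^ 4 : MvPolynomial (Fin 3) k) =
      monomial (Finsupp.single 0 3 + Finsupp.single 1 4 + Finsupp.single 2 4) 1 := by
    simp only [X_pow_eq_monomial, monomial_mul, mul_one]
  rw [hrange, hmon, mem_ideal_span_monomial_image]
  intro h
  obtain ⟨si, hsi, hle⟩ := h _ (by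
    rw [support_monomial, if_neg one_ne_zero]
    exact Finset.mem_singleton_self _)
  obtain ⟨i, rfl⟩ := hsi
  have h5 := Finsupp.single_le_iff.mp hle
  fin_cases i <;> simp at h5

/-- The forms `f = z² + x³ + y⁵` and `g = v² + yu³ + y³` lie in `(X₀, X₁, X₂)` and are non-zero.
[folklore] -/
theorem forms_mem_and_ne_zero :
    ((X 2 ^ 2 + X 0 ^ 3 + X 1 ^ 5 : MvPolynomial (Fin 3) k) ∈
        Ideal.span (Set.range (X : Fin 3 → MvPolynomial (Fin 3) k)) ∧
      (X 2 ^ 2 + X 0 ^ 3 + X 1 ^ 5 : MvPolynomial (Fin 3) k) ≠ 0) ∧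
    ((X 1 ^ 2 + X 2 * X 0 ^ 3 + X 2 ^ 3 : MvPolynomial (Fin 3) k) ∈
        Ideal.span (Set.range (X : Fin 3 → MvPolynomial (Fin 3) k)) ∧
      (X 1 ^ 2 + X 2 * X 0 ^ 3 + X 2 ^ 3 : MvPolynomial (Fin 3) k) ≠ 0) := by
  have hX : ∀ i : Fin 3, (X i : MvPolynomial (Fin 3) k) ∈
      Ideal.span (Set.range (X : Fin 3 → MvPolynomial (Fin 3) k)) :=
    fun i => Ideal.subset_span ⟨i, rfl⟩
  refine ⟨⟨?_, ?_⟩, ⟨?_, ?_⟩⟩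
  · exact add_mem (add_mem (Ideal.pow_mem_of_mem _ (hX 2) 2 (by norm_num))
      (Ideal.pow_mem_of_mem _ (hX 0) 3 (by norm_num))) (Ideal.pow_mem_of_mem _ (hX 1) 5 (by norm_num))
  · intro h0
    have h1 := congrArg (MvPolynomial.aeval (fun i : Fin 3 => (![0, 1, 0] : Fin 3 → k) i)) h0
    simp [Matrix.cons_val_zero, Matrix.cons_val_one, Matrix.cons_val] at h1
  · exact add_mem (add_mem (Ideal.pow_mem_of_mem _ (hX 1) 2 (by norm_num))
      (Ideal.mul_mem_left _ _ (Ideal.pow_mem_of_mem _ (hX 0) 3 (by norm_num))))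
      (Ideal.pow_mem_of_mem _ (hX 2) 3 (by norm_num))
  · intro h0
    have h1 := congrArg (MvPolynomial.aeval (fun i : Fin 3 => (![0, 1, 0] : Fin 3 → k) i)) h0
    simp [Matrix.cons_val_zero, Matrix.cons_val_one, Matrix.cons_val] at h1

variable [CharP k 5]

/-- **Fedder's test passes for `E₇` in characteristic `5`**: `g⁴ ∉ (u⁵, v⁵, y⁵) = 𝔪^[5]` for
`g = v² + y u³ + y³` over any field of characteristic `5` (the coefficient `12 ≡ 2` of `u³v⁴y⁴` is a
unit). [cite: Fedder1983, Prop. 1.7] -/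
theorem e7_fedder_char5 :
    (X 1 ^ 2 + X 2 * X 0 ^ 3 + X 2 ^ 3 : MvPolynomial (Fin 3) k) ^ 4 ∉
      Ideal.span (Set.range fun i : Fin 3 => (X i : MvPolynomial (Fin 3) k) ^ 5) := by
  set Q : Ideal (MvPolynomial (Fin 3) k) :=
    Ideal.span (Set.range fun i : Fin 3 => (X i : MvPolynomial (Fin 3) k) ^ 5) with hQ
  intro h
  have hXQ : ∀ i : Fin 3, (X i : MvPolynomial (Fin 3) k) ^ 5 ∈ Q := fun i => Ideal.subset_span ⟨i, rfl⟩
  -- the cofactor part lies in `Q`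
  have hq : ((6 * X 0 * X 2 ^ 8 + 12 * X 0 * X 1 ^ 2 * X 2 ^ 5 + 6 * X 0 * X 1 ^ 4 * X 2 ^ 2 +
          4 * X 0 ^ 4 * X 2 ^ 6 + 4 * X 0 ^ 4 * X 1 ^ 2 * X 2 ^ 3 + X 0 ^ 7 * X 2 ^ 4) * X 0 ^ 5 +
        (4 * X 1 * X 2 ^ 3 + X 1 ^ 3 + 4 * X 0 ^ 3 * X 1 * X 2) * X 1 ^ 5 +
        (X 2 ^ 7 + 4 * X 1 ^ 2 * X 2 ^ 4 + 6 * X 1 ^ 4 * X 2 + 4 * X 0 ^ 3 * X 2 ^ 5 +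
          12 * X 0 ^ 3 * X 1 ^ 2 * X 2 ^ 2) * X 2 ^ 5 : MvPolynomial (Fin 3) k) ∈ Q :=
    add_mem (add_mem (Ideal.mul_mem_left _ _ (hXQ 0)) (Ideal.mul_mem_left _ _ (hXQ 1)))
      (Ideal.mul_mem_left _ _ (hXQ 2))
  -- hence `12 · u³v⁴y⁴ ∈ Q`
  have h12 : (12 * (X 0 ^ 3 * X 1 ^ 4 * X 2 ^ 4) : MvPolynomial (Fin 3) k) ∈ Q := by
    have h' := sub_mem h hq
    rwa [e7_pow_four_eq, add_sub_cancel_right] at h'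
  -- `12` is a unit in characteristic `5`
  have hunit : (12 : k) ≠ 0 := by
    intro h0
    have h1 : ((12 : ℕ) : k) = 0 := by exact_mod_cast h0
    rw [CharP.cast_eq_zero_iff k 5] at h1
    omega
  have hm : (X 0 ^ 3 * X 1 ^ 4 * X 2 ^ 4 : MvPolynomial (Fin 3) k) ∈ Q := by
    have h' := Ideal.mul_mem_left Q (C (12 : k)⁻¹) h12
    have hC : (12 : MvPolynomial (Fin 3) k) = C (12 : k) := by
      rw [map_ofNat]
    rwa [hC, ← mul_assoc, ← map_mul, inv_mul_cancel₀ hunit, map_one, one_mul] at h'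
  exact monomial_notMem_frobeniusSpan k hm

/-- **`E₈⁰` at the origin violates the crux's clause in characteristic 5** (local-ring level): for
`S = k[X₀,X₁,X₂]`, `P = (X₀,X₁,X₂)`, the hypersurface local ring `S_P/(f)`, `f = X₂² + X₀³ + X₁⁵`, does
NOT satisfy "all s.o.p. weakly regular and all parameter ideals Frobenius closed" — it is Cohen–Macaulay
but not F-injective (`fedder_criterion_origin` with `e8_pow_four_mem`). [cite: Fedder1983, Thm. 1.12] -/
theorem e8_origin_not_clause_char5 (P : Ideal (MvPolynomial (Fin 3) k)) [P.IsMaximal]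
    (hP : P = Ideal.span (Set.range (MvPolynomial.X : Fin 3 → MvPolynomial (Fin 3) k))) :
    ¬ (∀ d : ℕ, ringKrullDim (Localization.AtPrime P ⧸ Ideal.span {algebraMap (MvPolynomial (Fin 3) k)
        (Localization.AtPrime P) (X 2 ^ 2 + X 0 ^ 3 + X 1 ^ 5)}) = d →
      ∀ s : Fin d → Localization.AtPrime P ⧸ Ideal.span {algebraMap (MvPolynomial (Fin 3) k)
          (Localization.AtPrime P) (X 2 ^ 2 + X 0 ^ 3 + X 1 ^ 5)},
        Ideal.IsMaximal (Ideal.radical (Ideal.span (Set.range s))) →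
          RingTheory.Sequence.IsWeaklyRegular (Localization.AtPrime P ⧸ Ideal.span
              {algebraMap (MvPolynomial (Fin 3) k) (Localization.AtPrime P) (X 2 ^ 2 + X 0 ^ 3 + X 1 ^ 5)})
            (List.ofFn s) ∧
          ∀ y : Localization.AtPrime P ⧸ Ideal.span {algebraMap (MvPolynomial (Fin 3) k)
              (Localization.AtPrime P) (X 2 ^ 2 + X 0 ^ 3 + X 1 ^ 5)},
            (∃ e : ℕ, y ^ 5 ^ e ∈ Ideal.span ((fun z : Localization.AtPrime P ⧸ Ideal.span
                {algebraMap (MvPolynomial (Fin 3) k) (Localization.AtPrime P) (X 2 ^ 2 + X 0 ^ 3 + X 1 ^ 5)}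
                  => z ^ 5 ^ e) '' (Ideal.span (Set.range s) : Set (Localization.AtPrime P ⧸ Ideal.span
                {algebraMap (MvPolynomial (Fin 3) k) (Localization.AtPrime P)
                  (X 2 ^ 2 + X 0 ^ 3 + X 1 ^ 5)})))) →
              y ∈ Ideal.span (Set.range s)) := by
  haveI : Fact (Nat.Prime 5) := ⟨Nat.prime_five⟩
  obtain ⟨⟨hfP, hf0⟩, -⟩ := forms_mem_and_ne_zero k
  rw [← hP] at hfP
  rw [fedder_criterion_origin 5 k 3 P hP _ hfP hf0, not_not]
  exact e8_pow_four_mem k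

/-- **The point blow-up F-injectivizes `E₈⁰` in characteristic 5, at its one singular point.** For
every field `k` of characteristic `5`, with `S = k[X₀, X₁, X₂]`, `P = (X₀, X₁, X₂)` and the regular
local ring `R = S_P`, the hypersurface local ring `R/(g)`, `g = X₁² + X₂X₀³ + X₂³` — the local ring at
the exceptional point of the `y`-chart of `Bl_𝔪 E₈⁰` (`e8_strictTransform_chart_y`), an `E₇`-type
rational double point — satisfies the per-stalk clause of crux `FInjectiveMacaulayfication`: every
system of parameters is a weakly regular sequence and every parameter ideal is Frobenius closed.
(`fedder_criterion_origin` with `e7_fedder_char5`; contrast `e8_origin_not_clause_char5` and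
`parameterCentre_noGo_of_not_fInjective`.) [cite: Fedder1983, Prop. 1.7 and Thm. 1.12] -/
theorem e7_chart_point_clause_char5 : ∀ (k : Type) [Field k] [CharP k 5] (P : Ideal (MvPolynomial (Fin 3) k)) [P.IsMaximal], P = Ideal.span (Set.range (MvPolynomial.X : Fin 3 → MvPolynomial (Fin 3) k)) → (∀ (I : Ideal (Localization.AtPrime P ⧸ Ideal.span {algebraMap (MvPolynomial (Fin 3) k) (Localization.AtPrime P) (MvPolynomial.X 1 ^ 2 + MvPolynomial.X 2 * MvPolynomial.X 0 ^ 3 + MvPolynomial.X 2 ^ 3)})) (y : Localization.AtPrime P ⧸ Ideal.span {algebraMap (MvPolynomial (Fin 3) k) (Localization.AtPrime P) (MvPolynomial.X 1 ^ 2 + MvPolynomial.X 2 * MvPolynomial.X 0 ^ 3 + MvPolynomial.X 2 ^ 3)}), (∃ e : ℕ, y ^ 5 ^ e ∈ Ideal.span ((fun z : Localization.AtPrime P ⧸ Ideal.span {algebraMap (MvPolynomial (Fin 3) k) (Localization.AtPrime P) (MvPolynomial.X 1 ^ 2 + MvPolynomial.X 2 * MvPolynomial.X 0 ^ 3 + MvPolynomial.X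 2 ^ 3)} => z ^ 5 ^ e) '' (I : Set (Localization.AtPrime P ⧸ Ideal.span {algebraMap (MvPolynomial (Fin 3) k) (Localization.AtPrime P) (MvPolynomial.X 1 ^ 2 + MvPolynomial.X 2 * MvPolynomial.X 0 ^ 3 + MvPolynomial.X 2 ^ 3)})))) → y ∈ I) ∧ ∀ d : ℕ, ringKrullDim (Localization.AtPrime P ⧸ Ideal.span {algebraMap (MvPolynomial (Fin 3) k) (Localization.AtPrime P) (MvPolynomial.X 1 ^ 2 + MvPolynomial.X 2 * MvPolynomial.X 0 ^ 3 + MvPolynomial.X 2 ^ 3)}) = d → ∀ s : Fin d → Localization.AtPrime P ⧸ Ideal.span {algebraMap (MvPolynomial (Fin 3) k) (Localization.AtPrime P) (MvPolynomial.X 1 ^ 2 + MvPolynomial.X 2 * MvPolynomial.X 0 ^ 3 + MvPolynomial.X 2 ^ 3)}, Ideal.IsMaximal (Ideal.radical (Ideal.span (Set.range s))) → RingTheory.Sequence.IsWeaklyRegular (Localization.AtPrime P ⧸ Ideal.span {algebraMap (MvPolynomial (Fin 3) k) (Localization.AtPrime P) (MvPolynomial.X 1 ^ 2 + MvPolynomial.X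 2 * MvPolynomial.X 0 ^ 3 + MvPolynomial.X 2 ^ 3)}) (List.ofFn s) := by
  intro k _ _ P _ hP
  haveI : Fact (Nat.Prime 5) := ⟨Nat.prime_five⟩
  obtain ⟨-, hgP, -⟩ := forms_mem_and_ne_zero k
  rw [← hP] at hgP
  -- `R = S_P` is a regular local ring of characteristic `5`
  haveI : IsRegularLocalRing (Localization.AtPrime P) := IsRegularRing.isRegularLocalRing_localization P
  have hinj : Function.Injective (algebraMap (MvPolynomial (Fin 3) k) (Localization.AtPrime P)) :=
    IsLocalization.injective (Localization.AtPrime P) P.primeCompl_le_nonZeroDivisors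
  haveI : CharP (Localization.AtPrime P) 5 := charP_of_injective_algebraMap hinj 5
  have hgm : algebraMap (MvPolynomial (Fin 3) k) (Localization.AtPrime P) (X 1 ^ 2 + X 2 * X 0 ^ 3 + X 2 ^ 3) ∈
      maximalIdeal (Localization.AtPrime P) := by
    rw [← IsLocalization.AtPrime.map_eq_maximalIdeal P (Localization.AtPrime P)]
    exact Ideal.mem_map_of_mem _ hgP
  -- Fedder's test, transported to `R`; then E2 gives even "every ideal Frobenius closed"
  have hfed : (algebraMap (MvPolynomial (Fin 3) k) (Localization.AtPrime P)
      (X 1 ^ 2 + X 2 * X 0 ^ 3 + X 2 ^ 3)) ^ (5 - 1) ∉ frobeniusPower 5 (maximalIdeal (Localization.AtPrime P)) :=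
    fun h => e7_fedder_char5 k
      ((algebraMap_pow_mem_frobeniusPower_maximalIdeal_iff k 3 5 P hP _ (5 - 1)).mp h)
  exact fedder_hypersurface_clause 5 (Localization.AtPrime P) _ hgm hfed

end FieldCase

end Summit.ResolutionOfSingularities.ResolutionOfSingularities.Theorems.FInjectiveMacaulayfication.E8Char5
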